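import Literature.MathematicalPhysics.QuantumFieldTheory.Balaban1983to89.B1Eq324BenfattoKernelSect5LedgerDischargeLower
import HarnessLib

/-!
# `Balaban1983to89.B1Eq324BenfattoKernelSect5LedgerDischargeUpper` — [BenfattoEtAl1978] p. 152 (4.6), p. 159 «In this case also we get (4.6)»,
# «Collecting all the errors» and «b*», for the CLASS of [Balaban1985BackgroundPropagators] Sect. E: UPPERPACK_CLASS — PROVED real analysis

doc: Literature/MathematicalPhysics/QuantumFieldTheory/Balaban1983to89/B1Eq324BenfattoLemma.md

WHY THIS MODULE (cell `pub-ymgap`, seat `dag-n08-b` gen 13; node N08 [Balaban1985UV3]).  The class (4.6) knit of seat n08-c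
(`…KernelSect5UpperAssembly.integral_condFieldK_le_exp_cumulantSum_add_of_ledger`, p627321) proves (4.6) for the conditioned Gaussian field of a
class kernel at the stopping index `n` from ONE displayed ledger `Σ_{i<n}(c′_i + idErr_i) ≤ E_tot`, `c′_i = err₅₁₁((γb_i)) + err₅₃₄(b_i) + 2P′_i`
(union-centre price over `(Λ−σ_{i+1}) ∖ ((C_i+τ_i) ∪ Γ₁)`), `idErr_i` the closed identification error with the letters `K_u(i) ≥ (1 + M₂V₄/(γ_A−J_c)(γ+1))b_i`,
`K₀(i)`, `ε₃₁(i) ≥ ε₁ ⊔ M₂V₄/(γ_A−J_c)(γe^{−θ(w−v)/4} + e^{−θR/4})b_i(1+√d(L−1))` and NO Appendix-A term.  This file is the class twin of print's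
UPPERPACK (`…Sect5LedgerDischargeUpper.upperpack`): the same ledger in nI-FORM (counts `↦ nI`, `nI·L^d`; union price in the closed form of
`…LedgerPrice.two_mul_price_union_le_closed` with `C_u = (1 + VM/(γ_A−J_c))²`; `|shrink| ↦ L^d`; letters at the explicit choices with the far radius
`R := b³` of print, «C at distance b³») at the cut-offs `b_j = b/γ^{j+1} ∈ [b, γ^{−(d+1)}b]` is `≤ nI·errTerm S ρ₁ ρ₂ ρ₃ ρ₄ A b t` for every stopping index
`n ≤ d + 1`, from the SAME threshold `b*` and in the SAME two-regime parameter scheme as the lower twin `…LedgerDischargeLower.lowerpack_class`, with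
the pavement side `L = ⌈b²⌉` and `w = 2v` EXPOSED in the `∃ L w v` clause (seat n08-c's word W2 for the `∃`-knit of the class Basic Lemma).

WHAT IS PROVED (no definition, no named fact, no `sorry`; axioms standard).
* §1 `KuU_nonneg`, `KuU_row`, `K0U_row`, `eps31U_row`, `regimeWidth_le_cube`, `four_pow_le_of_sq_le_one` — the UPPER letters in ledger normal form
  (`K_u ≤ C·b`, `K₀ ≤ C′·b`, `ε₃₁ ≤ C″·b³·e^{−θ(w−v)/4}` once `w − v ≤ b³`) and the width-versus-`b³` bookkeeping of the far radius.
* §2 `closed_price_le_errTerm_of_le_mul` (the closed price atom `…LedgerPrice.closed_price_le_errTerm` at a cut-off `c ≤ Γb`, `Γ ≥ 1`, constant `× Γ²`); the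
  five-summand fold is the lower twin's `nsmul_shape5_appA_le_errTerm` with a zero Appendix-A atom.
* §3 ★★★ `upperpack_class` — UPPERPACK FOR THE CLASS (statement-level mirror of `lowerpack_class`: `∃ S δ, … ∀ b > b*, ∃ L w v, L = ⌈b²⌉ ∧ w = 2v ∧ …
  ∧ ∀ s n nI A, n ≤ d+1 → 1 ≤ nI → 0 ≤ A → Σ_{j<n} STEP_U(b/γ^{j+1}) ≤ nI·errTerm S …`).

HONEST SCOPE / NOT HERE.  Elementary real analysis over displayed closed terms (no measure theory); the conversion of the knit's geometric `hledger`
to this nI-form (counts, union price) is the sibling `…KernelSect5LedgerBridgeUpper`; the `∃`-knit of the class Basic Lemma is seat n08-c's.  Count-neutral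
Literature helper of the class road (our class form of [BenfattoEtAl1978] §5; the port is NOT commissioned); nothing of [Balaban1985UV3]/[Balaban1984UV2]
is asserted; node N08 is NOT discharged; no summit statement is proved; the Yang–Mills mass gap (Clay) is NOT proved by any of this.
-/

noncomputable section

open Finset
open scoped BigOperators Nat

namespace Literature.MathematicalPhysics.QuantumFieldTheory.Balaban1983to89.B1Eq324BenfattoKernelSect5LedgerDischargeUpper

open Literature.MathematicalPhysics.QuantumFieldTheory.Balaban1983to89.B1Eq324BenfattoLemma
open Literature.MathematicalPhysics.QuantumFieldTheory.Balaban1983to89.B1Eq324BenfattoSect5ErrTermLedger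
open Literature.MathematicalPhysics.QuantumFieldTheory.Balaban1983to89.B1Eq324BenfattoSect5Eq511 (s1Const)
open Literature.MathematicalPhysics.QuantumFieldTheory.Balaban1983to89.B1Eq324GaussianMomentLeaf (momentConst)
open Literature.Probability.LatticeModels (setPartitions)
open Literature.MathematicalPhysics.QuantumFieldTheory.Balaban1983to89.B1Eq324BenfattoSect5LedgerDischarge
open Literature.MathematicalPhysics.QuantumFieldTheory.Balaban1983to89.B1Eq324BenfattoKernelSect5LedgerPrice
open Literature.MathematicalPhysics.QuantumFieldTheory.Balaban1983to89.B1Eq324BenfattoKernelSect5LedgerPerBox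
open Literature.MathematicalPhysics.QuantumFieldTheory.Balaban1983to89.B1Eq324BenfattoKernelSect5LedgerCumulant
open Literature.MathematicalPhysics.QuantumFieldTheory.Balaban1983to89.B1Eq324BenfattoSect5LedgerDischargeCumulant
open Literature.MathematicalPhysics.QuantumFieldTheory.Balaban1983to89.B1Eq324BenfattoSect5LedgerDischargeUpper
open Literature.MathematicalPhysics.QuantumFieldTheory.Balaban1983to89.B1Eq324BenfattoKernelSect5LedgerDischargeLower (K0_ties nsmul_shape5_appA_le_errTerm)

variable {d : ℕ}

/-! ## §1  The UPPER letters of the class (4.6) knit in ledger normal form; the far radius `R = b³` against the corridor width -/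

section Rows

variable {γA Jc V M V₂ M₂ V₄ θ γ b c Γ q C : ℝ} {L : ℕ}

/-- `0 ≤ K_u = (1 + M₂V₄/(γ_A − J_c)·(γ+1))·c` for `c ≥ 0`, `γ ≥ 0`, `M₂, V₄ ≥ 0`, `J_c < γ_A`.
[cite: BenfattoEtAl1978, §5 (5.36) p.159; Appendix D (5.29) p.157 (class form; ours)] -/
theorem KuU_nonneg (hM₂ : 0 ≤ M₂) (hV₄ : 0 ≤ V₄) (hJcγ : Jc < γA) (hγ0 : 0 ≤ γ) (hc : 0 ≤ c) :
    0 ≤ (1 + M₂ * V₄ / (γA - Jc) * (γ + 1)) * c := by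
  have : 0 ≤ M₂ * V₄ / (γA - Jc) * (γ + 1) := mul_nonneg (div_nonneg (mul_nonneg hM₂ hV₄) (by linarith)) (by linarith)
  exact mul_nonneg (by linarith) hc

/-- **The upper centre letter in normal form**: `K_u = (1 + M₂V₄/(γ_A − J_c)(γ+1))·c ≤ ((1 + M₂V₄/(γ_A − J_c)(γ+1))·Γ)·b` at a cut-off `0 ≤ c ≤ Γb`
(the row `hKu : K_u ≤ C_Ku·b` of `…LedgerPerBox.errPB_chi_class_le`). [cite: BenfattoEtAl1978, §5 (5.36) p.159 (class form; ours)] -/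
theorem KuU_row (hM₂ : 0 ≤ M₂) (hV₄ : 0 ≤ V₄) (hJcγ : Jc < γA) (hγ0 : 0 ≤ γ) (hcb : c ≤ Γ * b) :
    (1 + M₂ * V₄ / (γA - Jc) * (γ + 1)) * c ≤ ((1 + M₂ * V₄ / (γA - Jc) * (γ + 1)) * Γ) * b := by
  have hq : 0 ≤ 1 + M₂ * V₄ / (γA - Jc) * (γ + 1) := by
    have : 0 ≤ M₂ * V₄ / (γA - Jc) * (γ + 1) := mul_nonneg (div_nonneg (mul_nonneg hM₂ hV₄) (by linarith)) (by linarith)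
    linarith
  rw [mul_assoc]
  exact mul_le_mul_of_nonneg_left hcb hq

/-- **The upper moment letter in normal form**: `max(max 1 C, q·c) ≤ (max 1 C + q·Γ)·b` for `q ≥ 0`, `b ≥ 1`, `0 ≤ c ≤ Γb` (the rows `hK₀b`, `hc₀` of the
class per-box and cumulant atoms at `K₀ = max(max 1 (1/(γ_A−J_c)), K_u)`). [cite: BenfattoEtAl1978, Appendix D p.165 (class form; ours)] -/
theorem K0U_row (hq : 0 ≤ q) (hb : 1 ≤ b) (hc : 0 ≤ c) (hcb : c ≤ Γ * b) :
    max (max 1 C) (q * c) ≤ (max 1 C + q * Γ) * b := by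
  have hm1 : 1 ≤ max 1 C := le_max_left _ _
  have hm0 : 0 ≤ max 1 C := zero_le_one.trans hm1
  have hmb : max 1 C ≤ max 1 C * b := le_mul_of_one_le_right hm0 hb
  have hqc : q * c ≤ q * Γ * b := by rw [mul_assoc]; exact mul_le_mul_of_nonneg_left hcb hq
  have h0 : 0 ≤ max 1 C * b := mul_nonneg hm0 (zero_le_one.trans hb)
  have h0' : 0 ≤ q * Γ * b := (mul_nonneg hq hc).trans hqc
  refine max_le ?_ ?_ <;> nlinarith

/-- **The upper far-error letter in normal form, far radius `b³`**: with `ε₁ = V₂M₂/(γ_A−J_c)²·e^{−θn/2} + e^{−θn}/(γ_A−J_c)` and the UNION-centre row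
`ε₂ = M₂V₄/(γ_A−J_c)·(γe^{−θn/4} + e^{−θb³/4})·c·(1+√d(L−1))` at `0 ≤ c ≤ Γb`, `L ≤ 2b²`, `b ≥ 1`, `n ≤ b³`:
`ε₁ + ε₂ ≤ (V₂M₂/(γ_A−J_c)² + 1/(γ_A−J_c) + M₂V₄/(γ_A−J_c)·(γ+1)·Γ·(1+2√d))·b³·e^{−(θ/4)n}` — the row `hε` of `…LedgerPerBox.errPB_d31_class_le` with
`q_ε = 3`, `θ₁ = θ/4`. [cite: BenfattoEtAl1978, §5 (5.31) p.158, (5.36) p.159 «C at distance b³»; Appendix D (class form; ours)] -/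
theorem eps31U_row (hV₂ : 0 ≤ V₂) (hM₂ : 0 ≤ M₂) (hV₄ : 0 ≤ V₄) (hJcγ : Jc < γA) (hθ : 0 ≤ θ) (hb : 1 ≤ b) (hγ0 : 0 ≤ γ)
    (hc : 0 ≤ c) (hcb : c ≤ Γ * b) (hL1 : 1 ≤ ((L : ℕ) : ℝ)) (hL : ((L : ℕ) : ℝ) ≤ 2 * b ^ 2) (n : ℕ) (hn : (n : ℝ) ≤ b ^ 3) :
    (V₂ * M₂ / (γA - Jc) ^ 2 * Real.exp (-(θ / 2 * (n : ℝ))) + Real.exp (-(θ * (n : ℝ))) / (γA - Jc)) +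
        M₂ * V₄ / (γA - Jc) * (γ * Real.exp (-(θ / 4 * (n : ℝ))) + Real.exp (-(θ / 4 * b ^ 3))) * c *
          (1 + Real.sqrt d * (((L : ℕ) : ℝ) - 1)) ≤
      (V₂ * M₂ / (γA - Jc) ^ 2 + 1 / (γA - Jc) + M₂ * V₄ / (γA - Jc) * (γ + 1) * Γ * (1 + 2 * Real.sqrt d)) * b ^ 3 *
        Real.exp (-(θ / 4 * (n : ℝ))) := by
  have hgap : 0 < γA - Jc := by linarith
  have hb0 : 0 ≤ b := zero_le_one.trans hb
  have hn0 : (0 : ℝ) ≤ n := Nat.cast_nonneg n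
  have hb3 : 1 ≤ b ^ 3 := one_le_pow₀ hb
  set e4 : ℝ := Real.exp (-(θ / 4 * (n : ℝ))) with he4
  have he40 : 0 < e4 := Real.exp_pos _
  have h2 : Real.exp (-(θ / 2 * (n : ℝ))) ≤ e4 := Real.exp_le_exp.mpr (by nlinarith)
  have h1 : Real.exp (-(θ * (n : ℝ))) ≤ e4 := Real.exp_le_exp.mpr (by nlinarith)
  have hR : Real.exp (-(θ / 4 * b ^ 3)) ≤ e4 := Real.exp_le_exp.mpr (by nlinarith)
  have hA0 : 0 ≤ V₂ * M₂ / (γA - Jc) ^ 2 := by positivity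
  have hB0 : 0 ≤ 1 / (γA - Jc) := by positivity
  have hC0 : 0 ≤ M₂ * V₄ / (γA - Jc) := by positivity
  -- ε₁
  have hε₁ : V₂ * M₂ / (γA - Jc) ^ 2 * Real.exp (-(θ / 2 * (n : ℝ))) + Real.exp (-(θ * (n : ℝ))) / (γA - Jc) ≤
      (V₂ * M₂ / (γA - Jc) ^ 2 + 1 / (γA - Jc)) * b ^ 3 * e4 := by
    have ha : V₂ * M₂ / (γA - Jc) ^ 2 * Real.exp (-(θ / 2 * (n : ℝ))) ≤ V₂ * M₂ / (γA - Jc) ^ 2 * e4 :=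
      mul_le_mul_of_nonneg_left h2 hA0
    have hb' : Real.exp (-(θ * (n : ℝ))) / (γA - Jc) ≤ 1 / (γA - Jc) * e4 := by
      rw [div_eq_mul_one_div, mul_comm]
      exact mul_le_mul_of_nonneg_left h1 hB0
    have hsum : V₂ * M₂ / (γA - Jc) ^ 2 * e4 + 1 / (γA - Jc) * e4 = (V₂ * M₂ / (γA - Jc) ^ 2 + 1 / (γA - Jc)) * 1 * e4 := by ring
    calc _ ≤ V₂ * M₂ / (γA - Jc) ^ 2 * e4 + 1 / (γA - Jc) * e4 := add_le_add ha hb'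
      _ = (V₂ * M₂ / (γA - Jc) ^ 2 + 1 / (γA - Jc)) * 1 * e4 := hsum
      _ ≤ (V₂ * M₂ / (γA - Jc) ^ 2 + 1 / (γA - Jc)) * b ^ 3 * e4 :=
          mul_le_mul_of_nonneg_right (mul_le_mul_of_nonneg_left hb3 (by positivity)) he40.le
  -- ε₂ (union-centre row at the far radius `b³`)
  have hgl : 1 + Real.sqrt d * (((L : ℕ) : ℝ) - 1) ≤ (1 + 2 * Real.sqrt d) * b ^ 2 := by
    have hd0 : 0 ≤ Real.sqrt d := Real.sqrt_nonneg _
    have h1' : ((L : ℕ) : ℝ) - 1 ≤ 2 * b ^ 2 := by linarith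
    have hb2 : 1 ≤ b ^ 2 := one_le_pow₀ hb
    nlinarith [mul_le_mul_of_nonneg_left h1' hd0]
  have hgl0 : 0 ≤ 1 + Real.sqrt d * (((L : ℕ) : ℝ) - 1) := by
    have : 0 ≤ Real.sqrt d * (((L : ℕ) : ℝ) - 1) := mul_nonneg (Real.sqrt_nonneg _) (by linarith)
    linarith
  have hmix : γ * Real.exp (-(θ / 4 * (n : ℝ))) + Real.exp (-(θ / 4 * b ^ 3)) ≤ (γ + 1) * e4 := by
    rw [add_mul, one_mul]; exact add_le_add le_rfl hR
  have hmix0 : 0 ≤ γ * Real.exp (-(θ / 4 * (n : ℝ))) + Real.exp (-(θ / 4 * b ^ 3)) := by positivity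
  have hε₂ : M₂ * V₄ / (γA - Jc) * (γ * Real.exp (-(θ / 4 * (n : ℝ))) + Real.exp (-(θ / 4 * b ^ 3))) * c *
        (1 + Real.sqrt d * (((L : ℕ) : ℝ) - 1)) ≤
      (M₂ * V₄ / (γA - Jc) * (γ + 1) * Γ * (1 + 2 * Real.sqrt d)) * b ^ 3 * e4 := by
    calc M₂ * V₄ / (γA - Jc) * (γ * Real.exp (-(θ / 4 * (n : ℝ))) + Real.exp (-(θ / 4 * b ^ 3))) * c *
          (1 + Real.sqrt d * (((L : ℕ) : ℝ) - 1))
        ≤ M₂ * V₄ / (γA - Jc) * ((γ + 1) * e4) * (Γ * b) * ((1 + 2 * Real.sqrt d) * b ^ 2) := by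
          gcongr
          exact mul_nonneg (mul_nonneg hC0 (by positivity)) (hc.trans hcb)
      _ = (M₂ * V₄ / (γA - Jc) * (γ + 1) * Γ * (1 + 2 * Real.sqrt d)) * b ^ 3 * e4 := by ring
  calc _ ≤ (V₂ * M₂ / (γA - Jc) ^ 2 + 1 / (γA - Jc)) * b ^ 3 * e4 +
        (M₂ * V₄ / (γA - Jc) * (γ + 1) * Γ * (1 + 2 * Real.sqrt d)) * b ^ 3 * e4 := add_le_add hε₁ hε₂
    _ = _ := by rw [he4]; ring

/-- **The far radius `b³` dominates the corridor width in both regimes**: with the regime width `W = ⌈M_r b^{3/2}⌉` for `b ≥ b₀` and `W = v₀` below,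
`b ≥ 1`, `v₀ ≤ b` and `b₀ ≥ (10(d+1)(M_r+1))²`: `W ≤ b³`. [cite: BenfattoEtAl1978, §5 p.159 «corridors of width ≈ b^{3/2}», «C at distance b³»] -/
theorem regimeWidth_le_cube {Mr b₀ : ℝ} {v₀ : ℕ} (hMr : 0 < Mr) (hb : 1 ≤ b) (hv₀b : (v₀ : ℝ) ≤ b)
    (hb₀ : (10 * ((d : ℝ) + 1) * (Mr + 1)) ^ 2 ≤ b₀) :
    (((if b₀ ≤ b then ⌈Mr * b ^ (3 / 2 : ℝ)⌉₊ else v₀ : ℕ)) : ℝ) ≤ b ^ 3 := by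
  have hb0 : 0 ≤ b := zero_le_one.trans hb
  have hbb3 : b ≤ b ^ 3 := by nlinarith [one_le_pow₀ (n := 2) hb]
  split_ifs with h
  · have hx0 : 0 ≤ Mr * b ^ (3 / 2 : ℝ) := by positivity
    have hceil : ((⌈Mr * b ^ (3 / 2 : ℝ)⌉₊ : ℕ) : ℝ) ≤ Mr * b ^ (3 / 2 : ℝ) + 1 := (Nat.ceil_lt_add_one hx0).le
    have hM1 : Mr + 1 ≤ b := by
      have hd1 : (1 : ℝ) ≤ 10 * ((d : ℝ) + 1) := by
        have : (0 : ℝ) ≤ d := Nat.cast_nonneg d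
        linarith
      have hM10 : Mr + 1 ≤ 10 * ((d : ℝ) + 1) * (Mr + 1) := le_mul_of_one_le_left (by linarith) hd1
      have hsq : 10 * ((d : ℝ) + 1) * (Mr + 1) ≤ (10 * ((d : ℝ) + 1) * (Mr + 1)) ^ 2 := by nlinarith
      linarith
    have h32 : b ≤ b ^ (3 / 2 : ℝ) := by
      calc b = b ^ (1 : ℝ) := (Real.rpow_one _).symm
        _ ≤ b ^ (3 / 2 : ℝ) := Real.rpow_le_rpow_of_exponent_le hb (by norm_num)
    have h32' : b ^ (3 / 2 : ℝ) ≤ b ^ (2 : ℝ) := Real.rpow_le_rpow_of_exponent_le hb (by norm_num)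
    have hb2 : b ^ (2 : ℝ) = b ^ 2 := by norm_cast
    have h1 : (1 : ℝ) ≤ b ^ (3 / 2 : ℝ) := hb.trans h32
    calc ((⌈Mr * b ^ (3 / 2 : ℝ)⌉₊ : ℕ) : ℝ) ≤ Mr * b ^ (3 / 2 : ℝ) + 1 := hceil
      _ ≤ Mr * b ^ (3 / 2 : ℝ) + b ^ (3 / 2 : ℝ) := by linarith
      _ = (Mr + 1) * b ^ (3 / 2 : ℝ) := by ring
      _ ≤ b * b ^ 2 := by
          rw [← hb2]
          exact mul_le_mul hM1 h32' (zero_le_one.trans h1) hb0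
      _ = b ^ 3 := by ring
  · exact hv₀b.trans hbb3

/-- `(4/1²)^{d+1} ≤ (4/(γ^d)²)^{d+1}` for `0 < γ ≤ 1`: the lower twin's (5.19) threshold also serves the upper chain's (`γ′ = 1`).
[cite: BenfattoEtAl1978, (5.19) p.156] -/
theorem four_pow_le_of_sq_le_one (hγ0 : 0 < γ) (hγ1 : γ ≤ 1) :
    6 * 2 ^ d * ((d + 1).factorial : ℝ) * (4 / 1 ^ 2) ^ (d + 1) ≤ 6 * 2 ^ d * ((d + 1).factorial : ℝ) * (4 / (γ ^ d) ^ 2) ^ (d + 1) := by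
  have hg : 0 < (γ ^ d) ^ 2 := by positivity
  have hg1 : (γ ^ d) ^ 2 ≤ 1 := pow_le_one₀ (pow_nonneg hγ0.le _) (pow_le_one₀ hγ0.le hγ1)
  have h4 : 4 / 1 ^ 2 ≤ 4 / (γ ^ d) ^ 2 := by
    rw [one_pow, div_one]
    exact (le_div_iff₀ hg).mpr (by nlinarith)
  exact mul_le_mul_of_nonneg_left (pow_le_pow_left₀ (by norm_num) h4 _) (by positivity)

end Rows

/-! ## §2  The closed price at a cut-off above `b` -/

section Algebra

/-- **The closed class price at a cut-off `c ≤ Γb`, `Γ ≥ 1`** — `…LedgerPrice.closed_price_le_errTerm` (stated for `c ≤ b`) rescaled by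
`C_u·c² = (C_u Γ²)·(c/Γ)²`, `c/Γ ≤ b`: the same `nI·errTerm S_P …` with `C_u ↦ C_u·Γ²` in `S_P`.
[cite: BenfattoEtAl1978, §5 (5.34)–(5.36) p.159; Balaban1985BackgroundPropagators, (1.16)–(1.18) p.180 (class form; ours)] -/
theorem closed_price_le_errTerm_of_le_mul {θ Jc γA Cu c b Γ b₀ Mreg ρ₁ ρ₂ ρ₃ ρ₄ A N nI : ℝ} {L w v : ℕ} {t : ℕ}
    (hθ : 0 < θ) (hJc : 0 ≤ Jc) (hγA : 0 < γA) (hCu : 0 ≤ Cu)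
    (hb : 1 ≤ b) (hΓ : 1 ≤ Γ) (hc0 : 0 ≤ c) (hcb : c ≤ Γ * b) (hLb : (L : ℝ) ≤ 2 * b ^ 2) (hwv : w = 2 * v)
    (hN0 : 0 ≤ N) (hN : N ≤ nI) (hA : 0 ≤ A) (hb₀ : 0 ≤ b₀) (hρ₃ : 0 ≤ ρ₃) (hρ₄ : 1 ≤ ρ₄)
    (hreg : b₀ ≤ b → Mreg * b ^ (3 / 2 : ℝ) ≤ (v : ℝ)) (hM : ρ₃ + 1 ≤ θ * Mreg) :
    (32 * (Jc / γA) * (2 / (1 - Real.exp (-(θ / 2 / Real.sqrt d))) * Real.exp (θ / 2 / Real.sqrt d)) ^ d +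
          8 * Jc * Cu * c ^ 2 *
            ((2 * (1 + Real.sqrt d * ((L : ℝ) - 1)) ^ 2 + 128 / θ ^ 2) *
              (2 / (1 - Real.exp (-(θ / 4 / Real.sqrt d))) * Real.exp (θ / 4 / Real.sqrt d)) ^ d)) *
        (N * (L : ℝ) ^ d) * Real.exp (-(θ * w / 2))
      ≤ nI * errTerm
          ((2 ^ d * (32 * (Jc / γA) * (2 / (1 - Real.exp (-(θ / 2 / Real.sqrt d))) * Real.exp (θ / 2 / Real.sqrt d)) ^ d +
              8 * Jc * (Cu * Γ ^ 2) * (2 * (1 + 2 * Real.sqrt d) ^ 2 + 128 / θ ^ 2) *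
                (2 / (1 - Real.exp (-(θ / 4 / Real.sqrt d))) * Real.exp (θ / 4 / Real.sqrt d)) ^ d)) *
            (((2 * d + 6).factorial : ℝ) + b₀ ^ (2 * d + 6) * Real.exp (ρ₃ * b₀ ^ (3 / 2 : ℝ))))
          ρ₁ ρ₂ ρ₃ ρ₄ A b t := by
  have hΓ0 : 0 < Γ := lt_of_lt_of_le one_pos hΓ
  have hcΓ : c / Γ ≤ b := by rw [div_le_iff₀ hΓ0, mul_comm]; exact hcb
  have h := closed_price_le_errTerm (d := d) (ρ₁ := ρ₁) (ρ₂ := ρ₂) (t := t) (Cu := Cu * Γ ^ 2) (c := c / Γ)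
    hθ hJc hγA (by positivity) hb (by positivity) hcΓ hLb hwv hN0 hN hA hb₀ hρ₃ hρ₄ hreg hM
  have hΓne : Γ ≠ 0 := hΓ0.ne'
  have heq : 8 * Jc * (Cu * Γ ^ 2) * (c / Γ) ^ 2 = 8 * Jc * Cu * c ^ 2 := by field_simp
  rw [heq] at h
  exact h

end Algebra


/-! ## §3  UPPERPACK_CLASS -/

section Upper

set_option maxHeartbeats 1600000 in
/-- ★★★ **UPPERPACK FOR THE CLASS — the UPPER half of the class ledger socket, DISCHARGED.**  For `d ≥ 1`, class constants `γ_A > J_c ≥ 0`, `θ > 0`,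
`V, M, V₂, M₂, V₄ ≥ 0`, a contraction `0 < γ ≤ 1`, every `t, D`, `ϰ > 0`, all exponents with `ρ₁ ≥ D + 2d`, `ρ₂ ≥ 0`, `ρ₃ ≥ D + 2d`,
`ρ₄ ≥ 8·2^d·s₁(D)·γ^{−D(d+1)} + 1` and the SAME threshold `b* ≥ b*₀(d, γ, γ_A, θ, J_c)` as the lower twin (free of `t, D, ϰ`): there are `S ≥ 0` and a rate
`0 < δ ≤ θ/√d` with `δD²√d < ϰ` such that every `b > b*` admits `L, w, v` with `L = ⌈b²⌉`, `w = 2v` EXPOSED (seat n08-c's W2), the geometric side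
conditions (`2(2w+v) < L`, `(d+1)·2(2w+v) ≤ L`, `v ≤ w`, `1 ≤ w`, `1 ≤ b`, `L^d e^{−b²/4} ≤ 1/6`, the guard `J_c/(cosh θw − 1) < γ_A`, the width rows
`1 ≤ θw`, `4J_c/γ_A ≤ (θw)²` of the closed price, `w − v ≤ b³`), and —
for all `s`, every stopping index `n ≤ d + 1`, `nI ≥ 1`, `A ≥ 0` — the nI-FORM UPPER LEDGER of
`…KernelSect5UpperAssembly.integral_condFieldK_le_exp_cumulantSum_add_of_ledger` (its `hledger` with `|J_i|, |J_i+τ_i|, |B_i| ↦ nI`, `|Γ̄₁(B_i)| ↦ nI·L^d`,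
`Σ_□ ↦ nI·` at `|□′| ↦ L^d`, the union price in the closed form of `…LedgerPrice.two_mul_price_union_le_closed` with `C_u = (1 + VM/(γ_A−J_c))²`, the
letters at `K_u = (1 + M₂V₄/(γ_A−J_c)(γ+1))b_i`, `K₀ = max(max 1 (1/(γ_A−J_c)), K_u)`, `ε₃₁ = ε₁ + M₂V₄/(γ_A−J_c)(γe^{−θ(w−v)/4} + e^{−θb³/4})b_i(1+√d(L−1))`
(far radius `R = b³`), cut-offs `b_i = b/γ^{i+1}`, first summand at `(γb_i)^D`) `≤ nI·errTerm S ρ₁ ρ₂ ρ₃ ρ₄ A b t`.  Proof: the lower twin's scheme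
verbatim at the cut-offs `c = b/γ^{j+1} ∈ [b, γ^{−(d+1)}b]` (`…Sect5LedgerDischargeUpper.cutoff_upper`), the price by §2, the letters by §1.
[cite: BenfattoEtAl1978, Basic Lemma (4.6) p.152; §5 (5.36) p.159 «In this case also we get (4.6)», «Collecting all the errors», «b*» p.159;
Balaban1985BackgroundPropagators, (1.16)–(1.18) p.180, Sect. E p.428 (class form; ours)] -/
theorem upperpack_class (hd : 0 < d) {γA Jc θ V M V₂ M₂ V₄ : ℝ} (hγA0 : 0 < γA) (hJc0 : 0 ≤ Jc) (hJcγ : Jc < γA) (hθ : 0 < θ)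
    (hV : 0 ≤ V) (hM : 0 ≤ M) (hV₂ : 0 ≤ V₂) (hM₂ : 0 ≤ M₂) (hV₄ : 0 ≤ V₄)
    {γ : ℝ} (hγ0 : 0 < γ) (hγ1 : γ ≤ 1)
    (t D : ℕ) {κ : ℝ} (hκ : 0 < κ) {ρ₁ ρ₂ ρ₃ ρ₄ : ℝ}
    (hρ₁ : (D : ℝ) + 2 * d ≤ ρ₁) (hρ₂ : 0 ≤ ρ₂) (hρ₃ : (D : ℝ) + 2 * d ≤ ρ₃)
    (hρ₄ : 8 * s1Const D D d κ * (γ ^ (d + 1))⁻¹ ^ D * 2 ^ d + 1 ≤ ρ₄)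
    {bstar : ℝ} (hbs : 6 * 2 ^ d * ((d + 1).factorial : ℝ) * (4 / (γ ^ d) ^ 2) ^ (d + 1)
      + 10 * (d + 1) * ((⌈1 / (2 * θ) + Real.sqrt (Jc / γA) / θ⌉₊ + 1 : ℕ) : ℝ) + 2 / (γ ^ (d + 1) * Real.sqrt γA) + (γ ^ (d + 1))⁻¹ + 1 ≤ bstar) :
    ∃ S δ : ℝ, 0 ≤ S ∧ 0 < δ ∧ δ ≤ θ / Real.sqrt d ∧ 0 < κ / 2 - δ / 2 * ((D : ℝ) ^ 2 * Real.sqrt d) ∧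
      ∀ b : ℝ, bstar < b → ∃ L w v : ℕ, L = ⌈b ^ 2⌉₊ ∧ w = 2 * v ∧ 2 * (2 * w + v) < L ∧ (d + 1) * (2 * (2 * w + v)) ≤ L ∧ v ≤ w ∧ 1 ≤ w ∧
        1 ≤ b ∧ ((L : ℝ) ^ d) * Real.exp (-(b ^ 2 / 4)) ≤ 1 / 6 ∧
        Jc / (Real.cosh (θ * w) - 1) < γA ∧ 1 ≤ θ * w ∧ 4 * Jc / γA ≤ (θ * w) ^ 2 ∧ ((w - v : ℕ) : ℝ) ≤ b ^ 3 ∧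
        ∀ (s n : ℕ) (nI A : ℝ), n ≤ d + 1 → 1 ≤ nI → 0 ≤ A →
          ∑ j ∈ Finset.range n,
          (s1Const s D d κ * A * (γ * (b / γ ^ (j + 1))) ^ D * Real.exp (-(κ / 4 * w)) * nI
            + s1Const s D d κ * A * (b / γ ^ (j + 1)) ^ D *
              (Real.exp (-(κ / 4 * w)) * (nI * (L : ℝ) ^ d) + Real.exp (-(κ / 4 * v)) * (nI * (L : ℝ) ^ d))
            + (32 * (Jc / γA) * (2 / (1 - Real.exp (-(θ / 2 / Real.sqrt d))) * Real.exp (θ / 2 / Real.sqrt d)) ^ d +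
              8 * Jc * ((1 + V * M / (γA - Jc)) ^ 2) * (b / γ ^ (j + 1)) ^ 2 *
                ((2 * (1 + Real.sqrt d * ((L : ℝ) - 1)) ^ 2 + 128 / θ ^ 2) *
                  (2 / (1 - Real.exp (-(θ / 4 / Real.sqrt d))) * Real.exp (θ / 4 / Real.sqrt d)) ^ d)) *
            (nI * (L : ℝ) ^ d) * Real.exp (-(θ * w / 2))
          + (nI *
              (2 * (2 ^ ((t + 1).choose 2) * (4 * (s1Const s D d κ * A * (b / γ ^ (j + 1)) ^ D * (L : ℝ) ^ d)) ^ (t + 1) / (t + 1)!) +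
                    Real.exp (2 * (4 * (s1Const s D d κ * A * (b / γ ^ (j + 1)) ^ D * (L : ℝ) ^ d))) *
                      (3 * ((L : ℝ) ^ d * Real.exp (-((b / γ ^ (j + 1)) ^ 2 / 4)))) +
                    ∑ k ∈ Finset.range t,
                      (3 ^ (k + 1) * ((∑ π ∈ setPartitions (univ : Finset (Fin (k + 1))), ((π.card - 1)! : ℝ)) *
                          (s1Const s D d κ * A * (b / γ ^ (j + 1)) ^ D * Real.exp (-(κ / 4 * v)) * (L : ℝ) ^ d *
                            (4 * (s1Const s D d κ * A * (b / γ ^ (j + 1)) ^ D * (L : ℝ) ^ d)) ^ k)) +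
                        3 ^ (k + 1) * (2 ^ (k + 1) * ((∑ π ∈ setPartitions (univ : Finset (Fin (k + 1))), ((π.card - 1)! : ℝ)) *
                            ((min 1 (2 * (L : ℝ) ^ d * Real.exp (-((b / γ ^ (j + 1)) ^ 2 / 4)))) ^ ((2 * (k + 1) : ℕ) : ℝ)⁻¹ *
                              ((1 + ((1 + M₂ * V₄ / (γA - Jc) * (γ + 1)) * (b / γ ^ (j + 1)))) ^ D * (A * (L : ℝ) ^ d * ∑ p ∈ Finset.Icc 1 s, ((admissible p D).card : ℝ) *
              ((2 / (1 - Real.exp (-(κ / 2 / (p : ℕ) / Real.sqrt d))) * Real.exp (κ / 2 / (p : ℕ) / Real.sqrt d)) ^ d) ^ (p - 1)) * momentConst D (2 * (k + 1)) (max (max 1 (1 / (γA - Jc))) ((1 + M₂ * V₄ / (γA - Jc) * (γ + 1)) * (b / γ ^ (j + 1)))).toNNReal) ^ (k + 1))) +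
                          2 ^ ((k + 1) * D) * 2 ^ 2 ^ ((k + 1) * D) * (max (max 1 (1 / (γA - Jc))) ((1 + M₂ * V₄ / (γA - Jc) * (γ + 1)) * (b / γ ^ (j + 1)))) ^ ((k + 1) * D) * Real.exp (-(δ / 2 * ((v : ℝ) + 1))) *
                            (A * Real.exp (δ / 2 * ((D : ℝ) ^ 2 * d)) * (L : ℝ) ^ d * ∑ p ∈ Finset.Icc 1 s, ((admissible p D).card : ℝ) *
              ((2 / (1 - Real.exp (-((κ / 2 - δ / 2 * ((D : ℝ) ^ 2 * Real.sqrt d)) / (p : ℕ) / Real.sqrt d))) *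
                Real.exp ((κ / 2 - δ / 2 * ((D : ℝ) ^ 2 * Real.sqrt d)) / (p : ℕ) / Real.sqrt d)) ^ d) ^ (p - 1)) ^ (k + 1)) +
                        3 ^ (k + 1) * (2 ^ (k + 1) * ((∑ π ∈ setPartitions (univ : Finset (Fin (k + 1))), ((π.card - 1)! : ℝ)) *
                            ((min 1 (2 * (L : ℝ) ^ d * Real.exp (-((b / γ ^ (j + 1)) ^ 2 / 4)))) ^ ((2 * (k + 1) : ℕ) : ℝ)⁻¹ *
                              ((1 + ((1 + M₂ * V₄ / (γA - Jc) * (γ + 1)) * (b / γ ^ (j + 1)))) ^ D * (A * (L : ℝ) ^ d * ∑ p ∈ Finset.Icc 1 s, ((admissible p D).card : ℝ) *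
              ((2 / (1 - Real.exp (-(κ / 2 / (p : ℕ) / Real.sqrt d))) * Real.exp (κ / 2 / (p : ℕ) / Real.sqrt d)) ^ d) ^ (p - 1)) * momentConst D (2 * (k + 1)) (max (max 1 (1 / (γA - Jc))) ((1 + M₂ * V₄ / (γA - Jc) * (γ + 1)) * (b / γ ^ (j + 1)))).toNNReal) ^ (k + 1))) +
                          (A * (L : ℝ) ^ d * ∑ p ∈ Finset.Icc 1 s, ((admissible p D).card : ℝ) *
              ((2 / (1 - Real.exp (-(κ / 2 / (p : ℕ) / Real.sqrt d))) * Real.exp (κ / 2 / (p : ℕ) / Real.sqrt d)) ^ d) ^ (p - 1)) ^ (k + 1) * (2 ^ ((k + 1) * D) * 2 ^ 2 ^ ((k + 1) * D) *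
                            ((((k + 1) * D : ℕ) : ℝ) * (max (max 1 (1 / (γA - Jc))) ((1 + M₂ * V₄ / (γA - Jc) * (γ + 1)) * (b / γ ^ (j + 1)))) ^ ((k + 1) * D) * ((V₂ * M₂ / (γA - Jc) ^ 2 * Real.exp (-(θ / 2 * ((w - v : ℕ) : ℝ))) + Real.exp (-(θ * ((w - v : ℕ) : ℝ))) / (γA - Jc)) + M₂ * V₄ / (γA - Jc) * (γ * Real.exp (-(θ / 4 * ((w - v : ℕ) : ℝ))) + Real.exp (-(θ / 4 * b ^ 3))) * (b / γ ^ (j + 1)) * (1 + Real.sqrt d * ((L : ℝ) - 1))))))) / (k + 1)!) +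
            ∑ k ∈ Finset.range t,
          ((2 ^ (k + 1) * (2 ^ ((k + 1) * D) * 2 ^ 2 ^ ((k + 1) * D) * (max (max 1 (1 / (γA - Jc))) ((1 + M₂ * V₄ / (γA - Jc) * (γ + 1)) * (b / γ ^ (j + 1)))) ^ ((k + 1) * D)) *
          ((A * Real.exp (δ / 2 * ((D : ℝ) ^ 2 * d)) *
              Real.exp (-((κ / 2 - δ / 2 * ((D : ℝ) ^ 2 * Real.sqrt d)) / 2 * w))) * nI *
            ∑ p ∈ Finset.Icc 1 s, ((admissible p D).card : ℝ) *
              ((2 / (1 - Real.exp (-((κ / 2 - δ / 2 * ((D : ℝ) ^ 2 * Real.sqrt d)) / 2 / (p : ℕ) / Real.sqrt d))) *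
                Real.exp ((κ / 2 - δ / 2 * ((D : ℝ) ^ 2 * Real.sqrt d)) / 2 / (p : ℕ) / Real.sqrt d)) ^ d) ^ (p - 1)) *
          (A * Real.exp (δ / 2 * ((D : ℝ) ^ 2 * d)) *
            ((1 : ℝ) * (2 / (1 - Real.exp (-(δ / (2 * ((k + 1 : ℕ) : ℝ)) / Real.sqrt d))) * Real.exp (δ / (2 * ((k + 1 : ℕ) : ℝ)) / Real.sqrt d)) ^ d) *
            ∑ p ∈ Finset.Icc 1 s, ((admissible p D).card : ℝ) *
              ((2 / (1 - Real.exp (-((κ / 2 - δ / 2 * ((D : ℝ) ^ 2 * Real.sqrt d)) / (p : ℕ) / Real.sqrt d))) *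
                Real.exp ((κ / 2 - δ / 2 * ((D : ℝ) ^ 2 * Real.sqrt d)) / (p : ℕ) / Real.sqrt d)) ^ d) ^ (p - 1)) ^ k
          + 2 ^ (k + 1) * (2 ^ ((k + 1) * D) * 2 ^ 2 ^ ((k + 1) * D) * (max (max 1 (1 / (γA - Jc))) ((1 + M₂ * V₄ / (γA - Jc) * (γ + 1)) * (b / γ ^ (j + 1)))) ^ ((k + 1) * D)) *
        (nI * (A * Real.exp (δ / 2 * ((D : ℝ) ^ 2 * d)) * Real.exp (-((κ / 2 - δ / 2 * ((D : ℝ) ^ 2 * Real.sqrt d)) / 2 * v)) *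
          (L : ℝ) ^ d * ∑ p ∈ Finset.Icc 1 s, ((admissible p D).card : ℝ) *
              ((2 / (1 - Real.exp (-((κ / 2 - δ / 2 * ((D : ℝ) ^ 2 * Real.sqrt d)) / 2 / (p : ℕ) / Real.sqrt d))) *
                Real.exp ((κ / 2 - δ / 2 * ((D : ℝ) ^ 2 * Real.sqrt d)) / 2 / (p : ℕ) / Real.sqrt d)) ^ d) ^ (p - 1))) *
        (A * Real.exp (δ / 2 * ((D : ℝ) ^ 2 * d)) *
          (2 / (1 - Real.exp (-(δ / (2 * ((k + 1 : ℕ) : ℝ)) / Real.sqrt d))) * Real.exp (δ / (2 * ((k + 1 : ℕ) : ℝ)) / Real.sqrt d)) ^ d *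
          ∑ p ∈ Finset.Icc 1 s, ((admissible p D).card : ℝ) *
              ((2 / (1 - Real.exp (-((κ / 2 - δ / 2 * ((D : ℝ) ^ 2 * Real.sqrt d)) / (p : ℕ) / Real.sqrt d))) *
                Real.exp ((κ / 2 - δ / 2 * ((D : ℝ) ^ 2 * Real.sqrt d)) / (p : ℕ) / Real.sqrt d)) ^ d) ^ (p - 1)) ^ k)
          + (2 ^ (k + 1) * (2 ^ ((k + 1) * D) * 2 ^ 2 ^ ((k + 1) * D) * (max (max 1 (1 / (γA - Jc))) ((1 + M₂ * V₄ / (γA - Jc) * (γ + 1)) * (b / γ ^ (j + 1)))) ^ ((k + 1) * D)) *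
          (A * Real.exp (δ / 2 * ((D : ℝ) ^ 2 * d)) * Real.exp (-((κ / 2 - δ / 2 * ((D : ℝ) ^ 2 * Real.sqrt d)) / 2 * w)) *
            (nI * (L : ℝ) ^ d) * ∑ p ∈ Finset.Icc 1 s, ((admissible p D).card : ℝ) *
              ((2 / (1 - Real.exp (-((κ / 2 - δ / 2 * ((D : ℝ) ^ 2 * Real.sqrt d)) / 2 / (p : ℕ) / Real.sqrt d))) *
                Real.exp ((κ / 2 - δ / 2 * ((D : ℝ) ^ 2 * Real.sqrt d)) / 2 / (p : ℕ) / Real.sqrt d)) ^ d) ^ (p - 1)) *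
          (A * Real.exp (δ / 2 * ((D : ℝ) ^ 2 * d)) *
            (2 / (1 - Real.exp (-(δ / (2 * ((k + 1 : ℕ) : ℝ)) / Real.sqrt d))) * Real.exp (δ / (2 * ((k + 1 : ℕ) : ℝ)) / Real.sqrt d)) ^ d *
            ∑ p ∈ Finset.Icc 1 s, ((admissible p D).card : ℝ) *
              ((2 / (1 - Real.exp (-((κ / 2 - δ / 2 * ((D : ℝ) ^ 2 * Real.sqrt d)) / (p : ℕ) / Real.sqrt d))) *
                Real.exp ((κ / 2 - δ / 2 * ((D : ℝ) ^ 2 * Real.sqrt d)) / (p : ℕ) / Real.sqrt d)) ^ d) ^ (p - 1)) ^ k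
          + 2 ^ (k + 1) * (2 ^ ((k + 1) * D) * 2 ^ 2 ^ ((k + 1) * D) * (max (max 1 (1 / (γA - Jc))) ((1 + M₂ * V₄ / (γA - Jc) * (γ + 1)) * (b / γ ^ (j + 1)))) ^ ((k + 1) * D)) *
        (nI * (A * Real.exp (δ / 2 * ((D : ℝ) ^ 2 * d)) * Real.exp (-((κ / 2 - δ / 2 * ((D : ℝ) ^ 2 * Real.sqrt d)) / 2 * v)) *
          (L : ℝ) ^ d * ∑ p ∈ Finset.Icc 1 s, ((admissible p D).card : ℝ) *
              ((2 / (1 - Real.exp (-((κ / 2 - δ / 2 * ((D : ℝ) ^ 2 * Real.sqrt d)) / 2 / (p : ℕ) / Real.sqrt d))) *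
                Real.exp ((κ / 2 - δ / 2 * ((D : ℝ) ^ 2 * Real.sqrt d)) / 2 / (p : ℕ) / Real.sqrt d)) ^ d) ^ (p - 1))) *
        (A * Real.exp (δ / 2 * ((D : ℝ) ^ 2 * d)) *
          (2 / (1 - Real.exp (-(δ / (2 * ((k + 1 : ℕ) : ℝ)) / Real.sqrt d))) * Real.exp (δ / (2 * ((k + 1 : ℕ) : ℝ)) / Real.sqrt d)) ^ d *
          ∑ p ∈ Finset.Icc 1 s, ((admissible p D).card : ℝ) *
              ((2 / (1 - Real.exp (-((κ / 2 - δ / 2 * ((D : ℝ) ^ 2 * Real.sqrt d)) / (p : ℕ) / Real.sqrt d))) *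
                Real.exp ((κ / 2 - δ / 2 * ((D : ℝ) ^ 2 * Real.sqrt d)) / (p : ℕ) / Real.sqrt d)) ^ d) ^ (p - 1)) ^ k)
          + 2 ^ ((k + 1) * D) * 2 ^ 2 ^ ((k + 1) * D) * (max (max 1 (1 / (γA - Jc))) ((1 + M₂ * V₄ / (γA - Jc) * (γ + 1)) * (b / γ ^ (j + 1)))) ^ ((k + 1) * D) *
        (nI * (((k + 1 : ℕ) : ℝ) * (k : ℝ) *
          ((A * Real.exp (δ / 2 * ((D : ℝ) ^ 2 * d)) * ((L : ℝ) ^ d * (2 / (1 - Real.exp (-(δ / (2 * ((k + 1 : ℕ) : ℝ)) / Real.sqrt d))) * Real.exp (δ / (2 * ((k + 1 : ℕ) : ℝ)) / Real.sqrt d)) ^ d) *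
              ∑ p ∈ Finset.Icc 1 s, ((admissible p D).card : ℝ) *
              ((2 / (1 - Real.exp (-((κ / 2 - δ / 2 * ((D : ℝ) ^ 2 * Real.sqrt d)) / (p : ℕ) / Real.sqrt d))) *
                Real.exp ((κ / 2 - δ / 2 * ((D : ℝ) ^ 2 * Real.sqrt d)) / (p : ℕ) / Real.sqrt d)) ^ d) ^ (p - 1)) * ((A * Real.exp (δ / 2 * ((D : ℝ) ^ 2 * d)) * Real.exp (-(δ / (2 * ((k + 1 : ℕ) : ℝ)) / 2 * ((w : ℝ) + v + 1))) * ((L : ℝ) ^ d * (2 / (1 - Real.exp (-(δ / (2 * ((k + 1 : ℕ) : ℝ)) / 2 / Real.sqrt d))) * Real.exp (δ / (2 * ((k + 1 : ℕ) : ℝ)) / 2 / Real.sqrt d)) ^ d) *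
              ∑ p ∈ Finset.Icc 1 s, ((admissible p D).card : ℝ) *
              ((2 / (1 - Real.exp (-((κ / 2 - δ / 2 * ((D : ℝ) ^ 2 * Real.sqrt d)) / (p : ℕ) / Real.sqrt d))) *
                Real.exp ((κ / 2 - δ / 2 * ((D : ℝ) ^ 2 * Real.sqrt d)) / (p : ℕ) / Real.sqrt d)) ^ d) ^ (p - 1)) *
             (A * Real.exp (δ / 2 * ((D : ℝ) ^ 2 * d)) * ((L : ℝ) ^ d * (2 / (1 - Real.exp (-(δ / (2 * ((k + 1 : ℕ) : ℝ)) / Real.sqrt d))) * Real.exp (δ / (2 * ((k + 1 : ℕ) : ℝ)) / Real.sqrt d)) ^ d) *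
              ∑ p ∈ Finset.Icc 1 s, ((admissible p D).card : ℝ) *
              ((2 / (1 - Real.exp (-((κ / 2 - δ / 2 * ((D : ℝ) ^ 2 * Real.sqrt d)) / (p : ℕ) / Real.sqrt d))) *
                Real.exp ((κ / 2 - δ / 2 * ((D : ℝ) ^ 2 * Real.sqrt d)) / (p : ℕ) / Real.sqrt d)) ^ d) ^ (p - 1)) ^ (k - 1)))))
          + nI * ((3 : ℝ) ^ (k + 1) *
        (2 ^ ((k + 1) * D) * 2 ^ 2 ^ ((k + 1) * D) * (max (max 1 (1 / (γA - Jc))) ((1 + M₂ * V₄ / (γA - Jc) * (γ + 1)) * (b / γ ^ (j + 1)))) ^ ((k + 1) * D) *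
            Real.exp (-(δ / 2 * ((v : ℝ) + 1))) *
          (A * Real.exp (δ / 2 * ((D : ℝ) ^ 2 * d)) * (L : ℝ) ^ d * ∑ p ∈ Finset.Icc 1 s, ((admissible p D).card : ℝ) *
              ((2 / (1 - Real.exp (-((κ / 2 - δ / 2 * ((D : ℝ) ^ 2 * Real.sqrt d)) / (p : ℕ) / Real.sqrt d))) *
                Real.exp ((κ / 2 - δ / 2 * ((D : ℝ) ^ 2 * Real.sqrt d)) / (p : ℕ) / Real.sqrt d)) ^ d) ^ (p - 1)) ^ (k + 1)))) / (k + 1)!))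
            ≤ nI * errTerm S ρ₁ ρ₂ ρ₃ ρ₄ A b t := by
  -- §a  order / class constants
  have hd' : (0 : ℝ) < d := by exact_mod_cast hd
  have hκ0 : 0 ≤ κ := hκ.le
  have hρ₃0 : 0 ≤ ρ₃ := le_trans (by positivity) hρ₃
  have hρ31 : 0 ≤ ρ₃ + 1 := by linarith
  have hs1 : 0 ≤ s1Const D D d κ := s1Const_nonneg D D d hκ0
  have hΓ0 : (0 : ℝ) ≤ (γ ^ (d + 1))⁻¹ := by positivity
  have hΓ1 : (1 : ℝ) ≤ (γ ^ (d + 1))⁻¹ := one_le_inv_iff₀.mpr ⟨pow_pos hγ0 _, pow_le_one₀ hγ0.le hγ1⟩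
  have hρ₄1 : 1 ≤ ρ₄ := by
    have : 0 ≤ 8 * s1Const D D d κ * (γ ^ (d + 1))⁻¹ ^ D * 2 ^ d := by positivity
    linarith
  have hρ₄0 : 0 ≤ ρ₄ := zero_le_one.trans hρ₄1
  have hρ₄v : 8 * s1Const D D d κ * (γ ^ (d + 1))⁻¹ ^ D * 2 ^ d ≤ ρ₄ := by linarith
  have hgap : 0 < γA - Jc := by linarith
  have hsd : 0 < Real.sqrt d := Real.sqrt_pos.mpr hd'
  have hθd : 0 < θ / Real.sqrt d := div_pos hθ hsd
  have hCu0 : 0 ≤ 1 + V * M / (γA - Jc) := by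
    have : 0 ≤ V * M / (γA - Jc) := div_nonneg (mul_nonneg hV hM) hgap.le
    linarith
  have hqU : 0 ≤ 1 + M₂ * V₄ / (γA - Jc) * (γ + 1) := by
    have : 0 ≤ M₂ * V₄ / (γA - Jc) * (γ + 1) := mul_nonneg (div_nonneg (mul_nonneg hM₂ hV₄) hgap.le) (by linarith)
    linarith
  -- §b  the rate `δ ≤ θ/√d` with `δD²√d < ϰ`
  obtain ⟨δ, hδ, hδle, hres⟩ : ∃ δ : ℝ, 0 < δ ∧ δ ≤ θ / Real.sqrt d ∧ 0 < κ / 2 - δ / 2 * ((D : ℝ) ^ 2 * Real.sqrt d) := by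
    refine ⟨min (θ / Real.sqrt d) (κ / ((D : ℝ) ^ 2 * Real.sqrt d + 1)), lt_min hθd (by positivity), min_le_left _ _, ?_⟩
    set X : ℝ := (D : ℝ) ^ 2 * Real.sqrt d with hX
    have hX0 : 0 ≤ X := by positivity
    have h1 : min (θ / Real.sqrt d) (κ / (X + 1)) ≤ κ / (X + 1) := min_le_right _ _
    have h2 : κ / (X + 1) * X < κ := by
      have h3 : κ / (X + 1) * X = κ * (X / (X + 1)) := by ring
      rw [h3]
      exact mul_lt_of_lt_one_right hκ ((div_lt_one (by positivity)).mpr (by linarith))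
    nlinarith [mul_le_mul_of_nonneg_right h1 hX0]
  have hδ0 : 0 ≤ δ := hδ.le
  have hκ'0 : 0 ≤ κ / 2 - δ / 2 * ((D : ℝ) ^ 2 * Real.sqrt d) := hres.le
  -- §c  the corridor multiplier `M_reg`, the narrow width `v₀`, the regime threshold `b₀`
  obtain ⟨Mr, hMr0, hMκ, hMκ', hMδ, hML, hMe⟩ := exists_M_upper hρ31 hκ hres hδ (by positivity : 0 < θ / 4) t
  have hMθ : ρ₃ + 1 ≤ θ * Mr := hML.trans (by nlinarith)
  set v₀ : ℕ := ⌈1 / (2 * θ) + Real.sqrt (Jc / γA) / θ⌉₊ + 1 with hv₀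
  have hv₀1 : 1 ≤ v₀ := by rw [hv₀]; omega
  have hv₀ge : 1 / (2 * θ) + Real.sqrt (Jc / γA) / θ ≤ (v₀ : ℝ) := by
    rw [hv₀]; push_cast
    linarith [Nat.le_ceil (1 / (2 * θ) + Real.sqrt (Jc / γA) / θ)]
  have hsq0 : 0 ≤ Real.sqrt (Jc / γA) := Real.sqrt_nonneg _
  have hW1₀ : 1 ≤ 2 * θ * (v₀ : ℝ) := by
    have h1 : 1 / (2 * θ) ≤ (v₀ : ℝ) := le_trans (by linarith [div_nonneg hsq0 hθ.le]) hv₀ge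
    have h2 : 2 * θ * (1 / (2 * θ)) = 1 := by field_simp
    nlinarith [mul_le_mul_of_nonneg_left h1 (by positivity : (0 : ℝ) ≤ 2 * θ)]
  have hW2₀ : 4 * Jc / γA ≤ (2 * θ * (v₀ : ℝ)) ^ 2 := by
    have h1 : Real.sqrt (Jc / γA) / θ ≤ (v₀ : ℝ) := le_trans (by linarith [show 0 ≤ 1 / (2 * θ) by positivity]) hv₀ge
    have h2 : 2 * Real.sqrt (Jc / γA) ≤ 2 * θ * (v₀ : ℝ) := by
      have := mul_le_mul_of_nonneg_left h1 (by positivity : (0 : ℝ) ≤ 2 * θ)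
      rwa [show 2 * θ * (Real.sqrt (Jc / γA) / θ) = 2 * Real.sqrt (Jc / γA) by field_simp] at this
    have h3 : (2 * Real.sqrt (Jc / γA)) ^ 2 = 4 * Jc / γA := by
      rw [mul_pow, Real.sq_sqrt (div_nonneg hJc0 hγA0.le)]; ring
    rw [← h3]
    exact pow_le_pow_left₀ (by positivity) h2 2
  set b₀ : ℝ := (10 * ((d : ℝ) + 1) * (Mr + 1)) ^ 2 + ((v₀ : ℝ) / Mr + 1) ^ 2 with hb₀
  have hb₀0 : 0 ≤ b₀ := by rw [hb₀]; positivity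
  have hb₀fit : (10 * ((d : ℝ) + 1) * (Mr + 1)) ^ 2 ≤ b₀ := by rw [hb₀]; exact le_add_of_nonneg_right (by positivity)
  have hv₀M : (v₀ : ℝ) ≤ Mr * b₀ ^ (3 / 2 : ℝ) := by
    have h1 : ((v₀ : ℝ) / Mr + 1) ^ 2 ≤ b₀ := by rw [hb₀]; exact le_add_of_nonneg_left (by positivity)
    have h1' : 1 ≤ b₀ := le_trans (by nlinarith [show 0 ≤ (v₀ : ℝ) / Mr by positivity]) h1
    have h2 : b₀ ≤ b₀ ^ (3 / 2 : ℝ) := by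
      calc b₀ = b₀ ^ (1 : ℝ) := (Real.rpow_one _).symm
        _ ≤ b₀ ^ (3 / 2 : ℝ) := Real.rpow_le_rpow_of_exponent_le h1' (by norm_num)
    have h3 : (v₀ : ℝ) ≤ Mr * ((v₀ : ℝ) / Mr + 1) ^ 2 := by
      have h4 : Mr * ((v₀ : ℝ) / Mr + 1) ^ 2 = (v₀ : ℝ) ^ 2 / Mr + 2 * v₀ + Mr := by field_simp; ring
      rw [h4]
      nlinarith [show 0 ≤ (v₀ : ℝ) ^ 2 / Mr by positivity, show (0 : ℝ) ≤ v₀ from Nat.cast_nonneg v₀]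
    calc (v₀ : ℝ) ≤ Mr * ((v₀ : ℝ) / Mr + 1) ^ 2 := h3
      _ ≤ Mr * b₀ := mul_le_mul_of_nonneg_left h1 hMr0.le
      _ ≤ Mr * b₀ ^ (3 / 2 : ℝ) := mul_le_mul_of_nonneg_left h2 hMr0.le
  -- §d  the witnesses `S` (by unification at the very end) and `δ`
  refine ⟨?S, δ, ?hS, hδ, hδle, hres, fun b hb => ?main⟩
  case main =>
    -- thresholds from `b > b*`
    have hg : 0 < γ ^ (d + 1) := pow_pos hγ0 _
    have hg1 : γ ^ (d + 1) ≤ 1 := pow_le_one₀ hγ0.le hγ1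
    have hgd : 0 < γ ^ d := pow_pos hγ0 _
    have hT0 : 0 ≤ 6 * 2 ^ d * ((d + 1).factorial : ℝ) * (4 / (γ ^ d) ^ 2) ^ (d + 1) := by positivity
    have hT1 : 0 ≤ 10 * ((d : ℝ) + 1) * (v₀ : ℝ) := by positivity
    have hT2 : 0 ≤ 2 / (γ ^ (d + 1) * Real.sqrt γA) := by positivity
    have hT3 : 0 ≤ (γ ^ (d + 1))⁻¹ := by positivity
    have hbv₀ : ((⌈1 / (2 * θ) + Real.sqrt (Jc / γA) / θ⌉₊ + 1 : ℕ) : ℝ) = (v₀ : ℝ) := by rw [hv₀]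
    rw [hbv₀] at hbs
    have hb1 : 1 ≤ b := by linarith
    have hb0 : 0 ≤ b := by linarith
    have hbb : b ≤ b ^ 2 := by nlinarith
    have hthr : 6 * 2 ^ d * ((d + 1).factorial : ℝ) * (4 / (γ ^ d) ^ 2) ^ (d + 1) ≤ b ^ 2 := by linarith
    have h10 : 10 * ((d : ℝ) + 1) * v₀ ≤ b ^ 2 := by linarith
    have hterm0 : 2 / (γ ^ (d + 1) * Real.sqrt γA) ≤ b := by linarith
    have hgb1 : 1 ≤ γ ^ (d + 1) * b := by
      have h1 : (γ ^ (d + 1))⁻¹ ≤ b := by linarith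
      have := mul_le_mul_of_nonneg_left h1 hg.le
      rwa [mul_inv_cancel₀ hg.ne'] at this
    -- parameters
    set L : ℕ := ⌈b ^ 2⌉₊ with hLdef
    set W : ℕ := (if b₀ ≤ b then ⌈Mr * b ^ (3 / 2 : ℝ)⌉₊ else v₀) with hWdef
    have hL2b : ((L : ℕ) : ℝ) ≤ 2 * b ^ 2 := natCeil_sq_le_two_mul_sq hb1
    have hL1 : 1 ≤ ((L : ℕ) : ℝ) := one_le_natCeil_sq hb1
    have hthr1 : 6 * 2 ^ d * ((d + 1).factorial : ℝ) * (4 / 1 ^ 2) ^ (d + 1) ≤ b ^ 2 := (four_pow_le_of_sq_le_one (d := d) hγ0 hγ1).trans hthr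
    have hsmall : ((L : ℝ) ^ d) * Real.exp (-(b ^ 2 / 4)) ≤ 1 / 6 :=
      natCeil_sq_pow_mul_exp_le (d := d) (b := b) (c := b) (γ' := 1) one_pos hb1 (one_mul b).le hthr1
    have hW1 : 1 ≤ W := by rw [hWdef]; exact one_le_regimeV₀ hMr0 hb1 hv₀1
    have hv₀W : v₀ ≤ W := by rw [hWdef]; exact le_regimeV₀ hMr0.le hb₀0 hv₀M
    have hVreg : b₀ ≤ b → Mr * b ^ (3 / 2 : ℝ) ≤ (W : ℝ) := fun h => by rw [hWdef]; exact wide_of_regime₀ h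
    have hfit : (d + 1) * (2 * (2 * (2 * W) + W)) ≤ L := by rw [hWdef, hLdef]; exact shifts_fit_regime₀ hMr0.le hb₀fit h10
    obtain ⟨hwid1, hwid2⟩ := width_rows_of_le (Jc := Jc) (γA := γA) hθ hW1₀ hW2₀ hv₀W
    have hθw : 0 < θ * ((2 * W : ℕ) : ℝ) := lt_of_lt_of_le one_pos hwid1
    have hguard : Jc / (Real.cosh (θ * ((2 * W : ℕ) : ℝ)) - 1) < γA := guard_of_width hγA0 hθw hwid2
    have hv₀b : (v₀ : ℝ) ≤ b := by
      have h1 : (v₀ : ℝ) ≤ 10 * ((d : ℝ) + 1) * (v₀ : ℝ) := by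
        have hd1 : (1 : ℝ) ≤ 10 * ((d : ℝ) + 1) := by linarith [show (0 : ℝ) ≤ d from Nat.cast_nonneg d]
        exact le_mul_of_one_le_left (Nat.cast_nonneg v₀) hd1
      linarith
    have hR3 : ((2 * W - W : ℕ) : ℝ) ≤ b ^ 3 := by
      rw [show 2 * W - W = W by omega, hWdef]
      exact regimeWidth_le_cube (d := d) hMr0 hb1 hv₀b hb₀fit
    refine ⟨L, 2 * W, W, rfl, rfl, lt_of_succ_mul_le hd (by omega) hfit, hfit, by omega, by omega, hb1, hsmall, hguard, hwid1, hwid2, hR3,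
      fun s n nI A hn hnI hA => ?_⟩
    have hnI0 : 0 ≤ nI := by linarith
    have hwv : (2 * W : ℕ) = 2 * W := rfl
    have hvw : W ≤ 2 * W := by omega
    have hWreg : b₀ ≤ b → Mr * b ^ (3 / 2 : ℝ) ≤ ((2 * W : ℕ) : ℝ) := fun h => (hVreg h).trans (by push_cast; linarith)
    have hWVreg : b₀ ≤ b → Mr * b ^ (3 / 2 : ℝ) ≤ ((2 * W - W : ℕ) : ℝ) := by
      rw [show 2 * W - W = W by omega]; exact hVreg
    have hXv : (0 : ℝ) ≤ ((2 * W - W : ℕ) : ℝ) := Nat.cast_nonneg _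
    have hLd0 : (0 : ℝ) ≤ ((L : ℕ) : ℝ) ^ d := by positivity
    -- §e  cut-off facts on the upper chain (`c_j = b/γ^{j+1}`, next box `γ·c_j`, both in `[b, γ^{−(d+1)}b]`)
    have hcut := fun j (hj : j ∈ Finset.range (d + 1)) => cutoff_upper (d := d) hγ0 hγ1 hb1 hj
    -- the class letters at the cut-off `c_j`
    have hKu0 := fun j (hj : j ∈ Finset.range (d + 1)) => KuU_nonneg (M₂ := M₂) (V₄ := V₄) hM₂ hV₄ hJcγ hγ0.le (hcut j hj).1
    have hKu := fun j (hj : j ∈ Finset.range (d + 1)) => KuU_row (M₂ := M₂) (V₄ := V₄) hM₂ hV₄ hJcγ hγ0.le (hcut j hj).2.1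
    have hCKu : 0 ≤ (1 + M₂ * V₄ / (γA - Jc) * (γ + 1)) * (γ ^ (d + 1))⁻¹ := mul_nonneg hqU hΓ0
    have hK0 := fun j (hj : j ∈ Finset.range (d + 1)) =>
      K0U_row (C := 1 / (γA - Jc)) hqU hb1 (hcut j hj).1 (hcut j hj).2.1
    have hK00 := fun j (_ : j ∈ Finset.range (d + 1)) =>
      (le_trans zero_le_one (K0_ties ((1 + M₂ * V₄ / (γA - Jc) * (γ + 1)) * (b / γ ^ (j + 1))) (1 / (γA - Jc))).1)
    have hc₀ := fun j (hj : j ∈ Finset.range (d + 1)) =>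
      (show (((max (max 1 (1 / (γA - Jc))) ((1 + M₂ * V₄ / (γA - Jc) * (γ + 1)) * (b / γ ^ (j + 1)))).toNNReal : NNReal) : ℝ) ≤
          (max 1 (1 / (γA - Jc)) + (1 + M₂ * V₄ / (γA - Jc) * (γ + 1)) * (γ ^ (d + 1))⁻¹) * b by
        rw [Real.coe_toNNReal _ (hK00 j hj)]; exact hK0 j hj)
    have hgl0 : 0 ≤ 1 + Real.sqrt d * (((L : ℕ) : ℝ) - 1) := by
      have : 0 ≤ Real.sqrt d * (((L : ℕ) : ℝ) - 1) := mul_nonneg (Real.sqrt_nonneg _) (by linarith)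
      linarith
    have hε0 := fun j (hj : j ∈ Finset.range (d + 1)) =>
      (show 0 ≤ (V₂ * M₂ / (γA - Jc) ^ 2 * Real.exp (-(θ / 2 * ((2 * W - W : ℕ) : ℝ))) + Real.exp (-(θ * ((2 * W - W : ℕ) : ℝ))) / (γA - Jc)) +
          M₂ * V₄ / (γA - Jc) * (γ * Real.exp (-(θ / 4 * ((2 * W - W : ℕ) : ℝ))) + Real.exp (-(θ / 4 * b ^ 3))) * (b / γ ^ (j + 1)) *
            (1 + Real.sqrt d * (((L : ℕ) : ℝ) - 1)) by
        have h1 : 0 ≤ V₂ * M₂ / (γA - Jc) ^ 2 * Real.exp (-(θ / 2 * ((2 * W - W : ℕ) : ℝ))) := by positivity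
        have h2 : 0 ≤ Real.exp (-(θ * ((2 * W - W : ℕ) : ℝ))) / (γA - Jc) := div_nonneg (Real.exp_pos _).le hgap.le
        have h3 : 0 ≤ M₂ * V₄ / (γA - Jc) * (γ * Real.exp (-(θ / 4 * ((2 * W - W : ℕ) : ℝ))) + Real.exp (-(θ / 4 * b ^ 3))) *
            (b / γ ^ (j + 1)) * (1 + Real.sqrt d * (((L : ℕ) : ℝ) - 1)) :=
          mul_nonneg (mul_nonneg (mul_nonneg (div_nonneg (mul_nonneg hM₂ hV₄) hgap.le) (by positivity)) (hcut j hj).1) hgl0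
        exact add_nonneg (add_nonneg h1 h2) h3)
    have hε := fun j (hj : j ∈ Finset.range (d + 1)) =>
      eps31U_row (d := d) hV₂ hM₂ hV₄ hJcγ hθ.le hb1 hγ0.le (hcut j hj).1 (hcut j hj).2.1 hL1 hL2b (2 * W - W) hR3
    have hCε : 0 ≤ V₂ * M₂ / (γA - Jc) ^ 2 + 1 / (γA - Jc) + M₂ * V₄ / (γA - Jc) * (γ + 1) * (γ ^ (d + 1))⁻¹ * (1 + 2 * Real.sqrt d) := by
      positivity
    -- §f  STRUCTURAL atoms (print's, by name)
    have T1 := fun j (hj : j ∈ Finset.range (d + 1)) =>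
      struct₁_le (s := s) (D := D) (d := d) (t := t) (ρ₁ := ρ₁) (ρ₂ := ρ₂) (hκ := hκ0) (hA := hA) (hb := hb1) (hΓ := hΓ0) (hc := (hcut j hj).2.2.2.1)
        (hcb := (hcut j hj).2.2.2.2) (hb₀ := hb₀0) (hρ₃ := hρ₃0) (hρ₄ := hρ₄1) (hN0 := hnI0) (hNle := le_refl nI) (hreg := hWreg) (hM := hMκ)
    have T2 := fun j (hj : j ∈ Finset.range (d + 1)) =>
      struct₂_le (s := s) (D := D) (d := d) (t := t) (ρ₁ := ρ₁) (ρ₂ := ρ₂) (hκ := hκ0) (hA := hA) (hb := hb1) (hΓ := hΓ0) (hc := (hcut j hj).1)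
        (hcb := (hcut j hj).2.1) (hL := hL2b) (hvw := hvw) (hb₀ := hb₀0) (hρ₃ := hρ₃0) (hρ₄ := hρ₄1) (hnI := hnI0)
        (hN0 := mul_nonneg hnI0 hLd0) (hNle := le_refl (nI * ((L : ℕ) : ℝ) ^ d)) (hN'0 := hnI0) (hN'le := le_refl nI) (hreg := hVreg) (hM := hMκ)
    -- §g  the PRICE (class, nI-form)
    have P := fun j (hj : j ∈ Finset.range (d + 1)) =>
      closed_price_le_errTerm_of_le_mul (d := d) (ρ₁ := ρ₁) (ρ₂ := ρ₂) (t := t) (Cu := (1 + V * M / (γA - Jc)) ^ 2) hθ hJc0 hγA0 (sq_nonneg _)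
        hb1 hΓ1 (hcut j hj).1 (hcut j hj).2.1 hL2b hwv hnI0 (le_refl nI) hA hb₀0 hρ₃0 hρ₄1 hVreg hMθ
    -- §h  PER-BOX atoms (print's (g), (i1) by name; class (h), (i2), (i3), (i4))
    have R := fun j (hj : j ∈ Finset.range (d + 1)) =>
      errPB_remainder_le (t := t) (s := s) (D := D) (d := d) (ρ₃ := ρ₃) (hκ := hκ0) (hA := hA) (hb := hb1) (hΓ := hΓ0) (hc := (hcut j hj).1)
        (hcb := (hcut j hj).2.1) (hL := hL2b) (hρ₁ := hρ₁) (hρ₂ := hρ₂)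
    have Vol := fun j (hj : j ∈ Finset.range (d + 1)) =>
      errPB_volume_class_le (s := s) (D := D) (d := d) (hκ := hκ0) (hA := hA) (hb := hb1) (hΓ := hΓ0) (hc := (hcut j hj).1) (hcb := (hcut j hj).2.1)
        (hL := hL2b) (hV := le_refl (((L : ℕ) : ℝ) ^ d)) (hγ' := one_pos) (hγc := (hcut j hj).2.2.1) (hρ₃ := hρ₃) (hρ₄ := hρ₄v)
    have Eps := fun j (hj : j ∈ Finset.range (d + 1)) (k : ℕ) =>
      errPB_eps_le (s := s) (D := D) (d := d) (hκ := hκ0) (hA := hA) (hb := hb1) (hΓ := hΓ0) (hc := (hcut j hj).1) (hcb := (hcut j hj).2.1)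
        (hL := hL2b) (hb₀ := hb₀0) (hρ₃ := hρ₃0) (hρ₄ := hρ₄1) (hreg := hVreg) (hM := hMκ) k
    have Chi := fun j (hj : j ∈ Finset.range (d + 1)) (k : ℕ) =>
      errPB_chi_class_le (s := s) (D := D) (d := d)
        (c₀ := (max (max 1 (1 / (γA - Jc))) ((1 + M₂ * V₄ / (γA - Jc) * (γ + 1)) * (b / γ ^ (j + 1)))).toNNReal)
        (hκ := hκ0) (hA := hA) (hb := hb1) (hL := hL2b) (hKu0 := hKu0 j hj) (hKu := hKu j hj) (hCKu := hCKu) (hc₀ := hc₀ j hj)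
        (hV0 := hLd0) (hV := le_refl (((L : ℕ) : ℝ) ^ d)) (hγ' := one_pos) (hγc := (hcut j hj).2.2.1) (hρ₃ := hρ₃0) (hρ₄ := hρ₄1) k
    have D29 := fun j (hj : j ∈ Finset.range (d + 1)) (k : ℕ) =>
      errPB_d29_class_le (s := s) (D := D) (d := d) (hA := hA) (hb := hb1) (hL := hL2b) (hK₀ := hK00 j hj) (hK₀b := hK0 j hj)
        (hδ := hδ0) (hκ' := hκ'0) (hb₀ := hb₀0) (hρ₃ := hρ₃0) (hρ₄ := hρ₄1) (hreg := hVreg) (hM := hMδ) k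
    have D31 := fun j (hj : j ∈ Finset.range (d + 1)) (k : ℕ) =>
      errPB_d31_class_le (s := s) (D := D) (d := d) (qε := 3) (hκ := hκ0) (hA := hA) (hb := hb1) (hL := hL2b) (hK₀ := hK00 j hj) (hK₀b := hK0 j hj)
        (hε0 := hε0 j hj) (hCε := hCε) (hθ₁ := (by positivity : (0 : ℝ) ≤ θ / 4)) (hX := hXv) (hε := hε j hj)
        (hb₀ := hb₀0) (hρ₃ := hρ₃0) (hρ₄ := hρ₄1) (hreg := hWVreg) (hM := hML) k
    have KS := fun j (hj : j ∈ Finset.range (d + 1)) =>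
      (Finset.sum_le_sum fun k (_ : k ∈ Finset.range t) =>
        (div_le_div_of_nonneg_right
          (add_le_add (add_le_add (Eps j hj k)
            (mul_le_mul_of_nonneg_left (add_le_add (Chi j hj k) (D29 j hj k)) (pow_nonneg (by norm_num : (0 : ℝ) ≤ 3) (k + 1))))
            (mul_le_mul_of_nonneg_left (add_le_add (Chi j hj k) (D31 j hj k)) (pow_nonneg (by norm_num : (0 : ℝ) ≤ 3) (k + 1))))
          (Nat.cast_nonneg (k + 1)!)).trans_eq (three_div_eq _ _ _ _ _ _ _ _ _)).trans_eq (Finset.sum_mul _ _ _).symm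
    have T3 := fun j (hj : j ∈ Finset.range (d + 1)) =>
      mul_le_mul_of_nonneg_left ((add_le_add (add_le_add (R j hj) (Vol j hj)) (KS j hj)).trans_eq (err_shape_eq _ _ _ _ _)) hnI0
    -- §i  CUMULANT-SIDE atoms (class, `K₀ ≤ C_K0·b` row): (a) (b) (c) (d)=(b) (e) (f)
    have Ca := fun j (hj : j ∈ Finset.range (d + 1)) (k : ℕ) =>
      cum_a_class_le (s := s) (D := D) (d := d) (t := t) (ρ₁ := ρ₁) (ρ₂ := ρ₂) (hA := hA) (hb := hb1) (hL := hL2b) (hδ := hδ0) (hκ' := hκ'0)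
        (hb₀ := hb₀0) (hρ₃ := hρ₃0) (hρ₄ := hρ₄1) (hK₀ := hK00 j hj) (hK₀b := hK0 j hj) (hN0 := hnI0) (hNle := le_refl nI) (hreg := hWreg) (hM := hMκ') k
    have Cb := fun j (hj : j ∈ Finset.range (d + 1)) (k : ℕ) =>
      cum_b_class_le (s := s) (D := D) (d := d) (t := t) (ρ₁ := ρ₁) (ρ₂ := ρ₂) (hA := hA) (hb := hb1) (hL := hL2b) (hδ := hδ0) (hκ' := hκ'0)
        (hb₀ := hb₀0) (hρ₃ := hρ₃0) (hρ₄ := hρ₄1) (hK₀ := hK00 j hj) (hK₀b := hK0 j hj) (hN0 := hnI0) (hNle := le_refl nI) (hreg := hVreg) (hM := hMκ') k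
    have Cc := fun j (hj : j ∈ Finset.range (d + 1)) (k : ℕ) =>
      cum_c_class_le (s := s) (D := D) (d := d) (t := t) (ρ₁ := ρ₁) (ρ₂ := ρ₂) (hA := hA) (hb := hb1) (hL := hL2b) (hδ := hδ0) (hκ' := hκ'0)
        (hb₀ := hb₀0) (hρ₃ := hρ₃0) (hρ₄ := hρ₄1) (hK₀ := hK00 j hj) (hK₀b := hK0 j hj) (hnI := hnI0) (hN0 := mul_nonneg hnI0 hLd0)
        (hNle := le_refl (nI * ((L : ℕ) : ℝ) ^ d)) (hreg := hWreg) (hM := hMκ') k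
    have Ce := fun j (hj : j ∈ Finset.range (d + 1)) (k : ℕ) (hk : k ∈ Finset.range t) =>
      cum_e_class_le (s := s) (D := D) (d := d) (t := t) (ρ₁ := ρ₁) (ρ₂ := ρ₂) (w := 2 * W) (hA := hA) (hb := hb1) (hL := hL2b) (hδ := hδ0) (hκ' := hκ'0)
        (hb₀ := hb₀0) (hρ₃ := hρ₃0) (hρ₄ := hρ₄1) (hK₀ := hK00 j hj) (hK₀b := hK0 j hj) (hN0 := hnI0) (hNle := le_refl nI) (hreg := hVreg)
        (hM := hMe k (Finset.mem_range.mp hk))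
    have Cf := fun j (hj : j ∈ Finset.range (d + 1)) (k : ℕ) =>
      cum_f_class_le (s := s) (D := D) (d := d) (t := t) (ρ₁ := ρ₁) (ρ₂ := ρ₂) (hA := hA) (hb := hb1) (hL := hL2b) (hδ := hδ0) (hκ' := hκ'0)
        (hb₀ := hb₀0) (hρ₃ := hρ₃0) (hρ₄ := hρ₄1) (hK₀ := hK00 j hj) (hK₀b := hK0 j hj) (hN0 := hnI0) (hNle := le_refl nI) (hreg := hVreg) (hM := hMδ) k
    have T4 := fun j (hj : j ∈ Finset.range (d + 1)) =>
      (Finset.sum_le_sum fun k (hk : k ∈ Finset.range t) =>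
        (div_le_div_of_nonneg_right
          (add_le_add (add_le_add (add_le_add (add_le_add (Ca j hj k) (reassoc_b (Cb j hj k))) (add_le_add (Cc j hj k) (reassoc_b (Cb j hj k)))) (Ce j hj k hk))
            (Cf j hj k))
          (Nat.cast_nonneg (k + 1)!)).trans_eq (six_errTerm_div_eq _ _ _ _ _ _ _ _ _ _ _ _ _ _ _)).trans_eq
        (sum_mul_errTerm_eq _ _ _ _ _ _ _ _ _ _)
    -- §j  per step, the `n ≤ d + 1` steps, the fold (no Appendix-A atom on the upper side)
    have hF := fun j (hj : j ∈ Finset.range (d + 1)) =>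
      add_le_add (add_le_add (add_le_add (T1 j hj) (T2 j hj)) (P j hj)) (add_le_add (T3 j hj) (T4 j hj))
    have hsub : ∀ j ∈ Finset.range n, j ∈ Finset.range (d + 1) := fun j hj =>
      Finset.mem_range.mpr (lt_of_lt_of_le (Finset.mem_range.mp hj) hn)
    have SUM := (Finset.sum_le_sum fun j hj => hF j (hsub j hj)).trans_eq (by rw [Finset.sum_const, Finset.card_range])
    have h0 : (0 : ℝ) ≤ nI * (0 * (Real.exp (-(ρ₃ * b ^ (3 / 2 : ℝ))) * Real.exp (ρ₄ * A * b ^ ρ₃))) := by positivity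
    have key := (add_le_add SUM h0).trans (nsmul_shape5_appA_le_errTerm (t := t) hn hnI0 hA hb0)
    rw [add_zero] at key
    exact key
  case hS => exact le_max_right _ _

end Upper

end Literature.MathematicalPhysics.QuantumFieldTheory.Balaban1983to89.B1Eq324BenfattoKernelSect5LedgerDischargeUpper

end
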